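import Literature.Probability.Distributions.GaussianSphereMarginal
import Summits.QuantumFields.BalabanUV.T4Continuum.Support.NE9CutoffShell

/-!
# NE9RadialShell — the cut-off shell of a 𝔤-VALUED bond variable (`dim 𝔤 > 1`): a RADIAL Gaussian shell is still
LINEAR in its width (model certificate for residual line (R-9) of row NE9; cell `pub-balaban`, T4-DAG §2 node U3 /
§6 NE9; lineage t4-ne9-p1 = prover P1, generation 20; census E31 of `t4/T4-EST-NE9-P1.md` §27)

HONEST FRAMING (T4-DAG PAGE 1).  Rung (B)+1 on a FIXED finite torus with `FlowStep.BetaPertH` and (B) explicit — NOT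
infinite volume, NOT a mass gap, NOT the Clay problem.  NE9 is a cell NEW ESTIMATE and is NOT discharged here.  This module
is elementary Gaussian measure theory (`[folklore]`); [I] = [Balaban1987RG1], [II] = [Balaban1988RG2Cluster] are quoted for
the TYPE of the cut-off only (ABSOLUTE RULE).

WHY.  Print's small-field cut-off «χ({|B′(b)| < ε₁})» ([I] (2.9) p. 266; «{B : |B| < ε₁g_k^{−1} on Y}», [II] (1.34) p. 9)
is on a `𝔤`-VALUED bond variable (`dim 𝔤 = N² − 1` for SU(N)), `|·|` a Euclidean norm on `𝔤`.  The lineage's Gaussian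
certificates of the cut-off channel NE9-CUT (`NE9CutoffShell.gaussianReal_shell_le`, `NE9GaussianSlice`, `NE9TiltedShell`,
`NE9FormGaussian`) pin ONE SCALAR functional per bond, i.e. model `dim 𝔤 = 1`, where a shell `{a ≤ |x| < a′}` is two
intervals of length `a′ − a`.  For `dim 𝔤 = m > 1` the shell `{a ≤ ‖x‖ < a′}` is an annulus whose LEBESGUE volume grows
like `a^{m−1}(a′ − a)` — with `a = ε₁/g_k` a bound through the volume alone is NOT a bounded modulus in `t = g⁻²` (census
E31 (γ)).  THIS MODULE proves, for the centred ISOTROPIC model (the standard Gaussian of an `m`-dimensional inner product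
space), that the Gaussian weight restores linearity with an `a`-INDEPENDENT constant:

  `𝒩{x : a ≤ ‖x‖ < a′} ≤ m·vol(B₁)·(2π)^{−m/2}·e^{(m−1)(m−3)/2}·(a′ − a)`      (`stdGaussian_radialShell_le`)

by polar coordinates (tree `Literature.Probability.Distributions.lintegral_fun_norm_addHaar`, the `ℝ≥0∞` form of Mathlib's
`integral_fun_norm_addHaar`), the density of the standard Gaussian (tree `stdGaussian_eq_withDensity` /
`lintegral_stdGaussian_eq_lintegral_mul`) and the elementary bound `r^{m−1}e^{−r²/2} ≤ e^{(m−1)(m−3)/2}` (`r ≤ e^{r−1}`).  For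
`m = 1` the constant is `2/√(2π)`, the scalar certificate's.  With the thresholds of two couplings
(`NE9CutoffShell.shellWidth_eq`): `𝒩{ε₁/max(s,s′) ≤ ‖x‖ < ε₁/min(s,s′)} ≤ K_m·ε₁|s⁻¹ − s′⁻¹|` — LINEAR in the threshold
displacement, as node U3 needs.

NOT PROVED HERE (residual (R-9) as typed in §27.5 of the record): the ANISOTROPIC block covariance of Bałaban's `C^{(k)}(Z₀,0)`
at a bond (constant `‖A‖^{m−1}/det A` by the linear change of variables) and, above all, a NON-ZERO MEAN (the linear term
`−⟨B, Γ_kX⟩` of [II] (2.23) shifts the bond variable's mean; uniformity in the mean needs a spherical-cap estimate — not in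
Mathlib, not in the tree); the tilt and the dominated prefactor (absorbed by completing squares, `NE9TiltedShell`).  NOT
summit progress; 0/9 → 0/9.

References (TYPES only): [Balaban1987RG1] CMP 109 (1987) (2.9) p. 266; [Balaban1988RG2Cluster] CMP 116 (1988) (1.34) p. 9,
(2.3) p. 12, (2.23) p. 17.
v1.1 (same seat; APPEND-ONLY over v1 p204439, every v1 declaration byte-identical): §3 the ANISOTROPIC centred case —
`lintegral_scaledRadialShell_le` (radial shell at scale `n`), **`stdGaussian_linearRadialShell_le`** (`𝒩{a ≤ ‖Az‖ < a′} ≤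
|det A|⁻¹·‖A‖^{m−1}·K_m·(a′ − a)` for an invertible linear `A`, by `Measure.map_linearMap_addHaar_eq_smul_addHaar`).
-/

noncomputable section

namespace Summit.QuantumFields.BalabanUV.T4Continuum.NE9RadialShell

open MeasureTheory ProbabilityTheory Set Real Module Metric
open scoped ENNReal
open Literature.Probability.Distributions

variable {F : Type*} [NormedAddCommGroup F] [InnerProductSpace ℝ F] [FiniteDimensional ℝ F] [MeasurableSpace F]
  [BorelSpace F]

/-- The elementary bound behind the radial constant: `r^{m−1}·e^{−r²/2} ≤ e^{(m−1)(m−3)/2}` for `r ≥ 0` and `m ≥ 1`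
(`r ≤ e^{r−1}`, then complete the square `(m−1)(r−1) − r²/2 ≤ (m−1)²/2 − (m−1)`). [folklore] -/
theorem pow_mul_exp_neg_sq_le {m : ℕ} (hm : 1 ≤ m) {r : ℝ} (hr : 0 ≤ r) :
    r ^ (m - 1) * rexp (-r ^ 2 / 2) ≤ rexp (((m : ℝ) - 1) * ((m : ℝ) - 3) / 2) := by
  have h1 : r ≤ rexp (r - 1) := by
    have := Real.add_one_le_exp (r - 1)
    linarith
  have h2 : r ^ (m - 1) ≤ rexp ((((m - 1 : ℕ) : ℝ)) * (r - 1)) := by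
    calc r ^ (m - 1) ≤ (rexp (r - 1)) ^ (m - 1) := pow_le_pow_left₀ hr h1 _
      _ = rexp ((((m - 1 : ℕ) : ℝ)) * (r - 1)) := by rw [← Real.exp_nat_mul]
  have hcast : (((m - 1 : ℕ) : ℝ)) = (m : ℝ) - 1 := by
    rw [Nat.cast_sub hm, Nat.cast_one]
  rw [hcast] at h2
  calc r ^ (m - 1) * rexp (-r ^ 2 / 2) ≤ rexp (((m : ℝ) - 1) * (r - 1)) * rexp (-r ^ 2 / 2) :=
        mul_le_mul_of_nonneg_right h2 (Real.exp_pos _).le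
    _ = rexp (((m : ℝ) - 1) * (r - 1) + -r ^ 2 / 2) := by rw [Real.exp_add]
    _ ≤ rexp (((m : ℝ) - 1) * ((m : ℝ) - 3) / 2) := by
        apply Real.exp_le_exp.2
        nlinarith [sq_nonneg (r - ((m : ℝ) - 1))]

/-- The radial shell constant of the `m`-dimensional standard Gaussian:
`K_m = m · vol(B₁) · (2π)^{−m/2} · e^{(m−1)(m−3)/2}` (for `m = 1`: `2/√(2π)`). [folklore] -/
def radialShellConst (F : Type*) [NormedAddCommGroup F] [InnerProductSpace ℝ F] [FiniteDimensional ℝ F]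
    [MeasurableSpace F] [BorelSpace F] : ℝ :=
  finrank ℝ F * (volume : Measure F).real (ball 0 1) * ((2 * π) ^ (-(finrank ℝ F : ℝ) / 2) *
    rexp (((finrank ℝ F : ℝ) - 1) * ((finrank ℝ F : ℝ) - 3) / 2))

/-- `K_m ≥ 0`. [folklore] -/
theorem radialShellConst_nonneg : 0 ≤ radialShellConst F := by
  unfold radialShellConst
  positivity

/-- **A RADIAL SHELL OF THE STANDARD GAUSSIAN IS LINEAR IN ITS WIDTH, with an `a`-independent constant**: on an
`m`-dimensional real inner product space (`m ≥ 1`), for any real `a, a′` (the bound is trivial unless `a < a′`),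
`𝒩{x : a ≤ ‖x‖ < a′} ≤ m·vol(B₁)·(2π)^{−m/2}·e^{(m−1)(m−3)/2}·(a′ − a)` — polar coordinates
(`lintegral_fun_norm_addHaar`), the Gaussian density (`lintegral_stdGaussian_eq_lintegral_mul`), and `pow_mul_exp_neg_sq_le`
on the radial factor `r^{m−1}e^{−r²/2}`.  The model certificate for residual line (R-9) of row NE9 (a `𝔤`-valued bond variable,
centred isotropic case). [cite: Balaban1988RG2Cluster, (1.34) p.9 and (2.3) p.12; Balaban1987RG1, (2.9) p.266] -/
theorem stdGaussian_radialShell_le [Nontrivial F] (a a' : ℝ) :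
    stdGaussian F {x : F | a ≤ ‖x‖ ∧ ‖x‖ < a'} ≤ ENNReal.ofReal (radialShellConst F * (a' - a)) := by
  set d : ℕ := finrank ℝ F with hd
  have hd1 : 1 ≤ d := Module.finrank_pos
  set c : ℝ := (2 * π) ^ (-(d : ℝ) / 2) with hc
  have hc0 : 0 ≤ c := by positivity
  set M : ℝ := rexp (((d : ℝ) - 1) * ((d : ℝ) - 3) / 2) with hM
  set S : Set F := {x : F | a ≤ ‖x‖ ∧ ‖x‖ < a'} with hS
  have hSeq : S = (fun x : F => ‖x‖) ⁻¹' Ico a a' := by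
    ext x; simp [hS, Set.mem_Ico]
  have hSm : MeasurableSet S := by
    rw [hSeq]; exact measurable_norm measurableSet_Ico
  -- the radial integrand
  set f : ℝ → ℝ≥0∞ := fun y => ENNReal.ofReal (c * rexp (-y ^ 2 / 2)) * (Ico a a').indicator 1 y with hf
  have hfm : Measurable f := by
    refine Measurable.mul (by fun_prop) ?_
    exact (measurable_const.indicator measurableSet_Ico)
  -- Step 1: the measure as a Gaussian integral of the indicator, then as a Lebesgue integral of a radial function
  have h1 : stdGaussian F S = ∫⁻ x, f ‖x‖ ∂(volume : Measure F) := by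
    rw [← lintegral_indicator_one hSm, lintegral_stdGaussian_eq_lintegral_mul (measurable_one.indicator hSm)]
    refine lintegral_congr fun x => ?_
    have hind : S.indicator (1 : F → ℝ≥0∞) x = (Ico a a').indicator 1 ‖x‖ := by
      rw [hSeq]
      rfl
    rw [hind]
  -- Step 2: polar coordinates
  have h2 := lintegral_fun_norm_addHaar (volume : Measure F) f hfm
  -- Step 3: the radial integral is at most c·M·(a′ − a)
  have h3 : ∫⁻ y in Ioi (0 : ℝ), ENNReal.ofReal (y ^ (d - 1)) * f y ≤ ENNReal.ofReal (c * M * (a' - a)) := by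
    have hpt : ∀ y ∈ Ioi (0 : ℝ), ENNReal.ofReal (y ^ (d - 1)) * f y ≤
        (Ico a a').indicator (fun _ => ENNReal.ofReal (c * M)) y := by
      intro y hy
      by_cases hyI : y ∈ Ico a a'
      · rw [hf]
        simp only [indicator_of_mem hyI, Pi.one_apply, mul_one]
        rw [← ENNReal.ofReal_mul (pow_nonneg (le_of_lt hy) _)]
        refine ENNReal.ofReal_le_ofReal ?_
        have hb := pow_mul_exp_neg_sq_le hd1 (le_of_lt hy)
        calc y ^ (d - 1) * (c * rexp (-y ^ 2 / 2)) = c * (y ^ (d - 1) * rexp (-y ^ 2 / 2)) := by ring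
          _ ≤ c * M := mul_le_mul_of_nonneg_left hb hc0
      · rw [hf]
        simp only [indicator_of_notMem hyI, mul_zero, le_refl]
    calc ∫⁻ y in Ioi (0 : ℝ), ENNReal.ofReal (y ^ (d - 1)) * f y
        ≤ ∫⁻ y in Ioi (0 : ℝ), (Ico a a').indicator (fun _ => ENNReal.ofReal (c * M)) y :=
          setLIntegral_mono (measurable_const.indicator measurableSet_Ico) hpt
      _ ≤ ∫⁻ y, (Ico a a').indicator (fun _ => ENNReal.ofReal (c * M)) y := setLIntegral_le_lintegral _ _
      _ = ENNReal.ofReal (c * M) * volume (Ico a a') := by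
          rw [lintegral_indicator measurableSet_Ico, setLIntegral_const]
      _ = ENNReal.ofReal (c * M * (a' - a)) := by
          rw [Real.volume_Ico, ← ENNReal.ofReal_mul (by positivity)]
  -- Step 4: assemble
  have hball : (volume : Measure F) (ball 0 1) = ENNReal.ofReal ((volume : Measure F).real (ball 0 1)) := by
    rw [measureReal_def, ENNReal.ofReal_toReal measure_ball_lt_top.ne]
  rw [h1, h2]
  calc (finrank ℝ F : ℝ≥0∞) * volume (ball (0 : F) 1) * ∫⁻ y in Ioi (0 : ℝ), ENNReal.ofReal (y ^ (finrank ℝ F - 1)) * f y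
      ≤ (finrank ℝ F : ℝ≥0∞) * volume (ball (0 : F) 1) * ENNReal.ofReal (c * M * (a' - a)) := by
        gcongr
    _ = ENNReal.ofReal (radialShellConst F * (a' - a)) := by
        rw [hball, radialShellConst, ← hd, ← ENNReal.ofReal_natCast d,
          ← ENNReal.ofReal_mul (by positivity), ← ENNReal.ofReal_mul (by positivity)]
        congr 1
        simp only [hc, hM]
        ring

/-- **THE CUT-OFF SHELL OF A 𝔤-VALUED BOND VARIABLE BETWEEN THE THRESHOLDS OF TWO COUPLINGS** (centred isotropic model):
`𝒩{ε₁/max(s,s′) ≤ ‖x‖ < ε₁/min(s,s′)} ≤ K_m · ε₁|s⁻¹ − s′⁻¹|` (`s, s′ > 0`, any real `ε₁`) — LINEAR in the threshold displacement,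
hence a bounded modulus in `t = g⁻²` on `]0, γ]` (`NE9CutoffShell.inv_sub_inv_le`), exactly as in the scalar certificate
`NE9CutoffShell.gaussianReal_thresholdShell_le` (`s, s′ > 0`). [cite: Balaban1988RG2Cluster, (1.34) p.9 and (2.3) p.12] -/
theorem stdGaussian_thresholdShell_le [Nontrivial F] (ε₁ : ℝ) {s s' : ℝ} (hs : 0 < s) (hs' : 0 < s') :
    stdGaussian F {x : F | ε₁ / max s s' ≤ ‖x‖ ∧ ‖x‖ < ε₁ / min s s'} ≤
      ENNReal.ofReal (radialShellConst F * (ε₁ * |s⁻¹ - s'⁻¹|)) := by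
  rw [← NE9CutoffShell.shellWidth_eq hs hs']
  exact stdGaussian_radialShell_le _ _

/-! ## §3 (v1.1) ANISOTROPIC (centred) bond covariance: a linear change of variables -/

/-- Scaled radial bound: `r^{m−1}·e^{−r²/(2n²)} ≤ n^{m−1}·e^{(m−1)(m−3)/2}` for `n > 0`, `r ≥ 0`, `m ≥ 1`
(`pow_mul_exp_neg_sq_le` at `r/n`). [folklore] -/
theorem pow_mul_exp_neg_sq_div_le {m : ℕ} (hm : 1 ≤ m) {n r : ℝ} (hn : 0 < n) (hr : 0 ≤ r) :
    r ^ (m - 1) * rexp (-r ^ 2 / (2 * n ^ 2)) ≤ n ^ (m - 1) * rexp (((m : ℝ) - 1) * ((m : ℝ) - 3) / 2) := by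
  have h := pow_mul_exp_neg_sq_le hm (div_nonneg hr hn.le)
  have e1 : r ^ (m - 1) = n ^ (m - 1) * (r / n) ^ (m - 1) := by
    rw [div_pow, mul_div_cancel₀]
    exact pow_ne_zero _ hn.ne'
  have e2 : -r ^ 2 / (2 * n ^ 2) = -(r / n) ^ 2 / 2 := by
    rw [div_pow]
    field_simp
  rw [e1, e2, mul_assoc]
  exact mul_le_mul_of_nonneg_left h (pow_nonneg hn.le _)

/-- **The radial Gaussian shell at scale `n`** (Lebesgue form): for `n > 0` and any real `a, a′`,
`∫ 1{a ≤ ‖y‖ < a′}·(2π)^{−m/2}e^{−‖y‖²/(2n²)} dy ≤ n^{m−1}·K_m·(a′ − a)` — polar coordinates and the scaled radial bound.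
[folklore] -/
theorem lintegral_scaledRadialShell_le [Nontrivial F] {n : ℝ} (hn : 0 < n) (a a' : ℝ) :
    ∫⁻ y, ENNReal.ofReal ((2 * π) ^ (-(finrank ℝ F : ℝ) / 2) * rexp (-‖y‖ ^ 2 / (2 * n ^ 2))) *
        (Ico a a').indicator 1 ‖y‖ ∂(volume : Measure F) ≤
      ENNReal.ofReal (n ^ (finrank ℝ F - 1) * radialShellConst F * (a' - a)) := by
  set d : ℕ := finrank ℝ F with hd
  have hd1 : 1 ≤ d := Module.finrank_pos
  set c : ℝ := (2 * π) ^ (-(d : ℝ) / 2) with hc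
  have hc0 : 0 ≤ c := by positivity
  set M : ℝ := rexp (((d : ℝ) - 1) * ((d : ℝ) - 3) / 2) with hM
  set f : ℝ → ℝ≥0∞ := fun y => ENNReal.ofReal (c * rexp (-y ^ 2 / (2 * n ^ 2))) * (Ico a a').indicator 1 y with hf
  have hfm : Measurable f := by
    refine Measurable.mul (by fun_prop) ?_
    exact (measurable_const.indicator measurableSet_Ico)
  have h2 := lintegral_fun_norm_addHaar (volume : Measure F) f hfm
  have h3 : ∫⁻ y in Ioi (0 : ℝ), ENNReal.ofReal (y ^ (d - 1)) * f y ≤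
      ENNReal.ofReal (c * (n ^ (d - 1) * M) * (a' - a)) := by
    have hpt : ∀ y ∈ Ioi (0 : ℝ), ENNReal.ofReal (y ^ (d - 1)) * f y ≤
        (Ico a a').indicator (fun _ => ENNReal.ofReal (c * (n ^ (d - 1) * M))) y := by
      intro y hy
      by_cases hyI : y ∈ Ico a a'
      · rw [hf]
        simp only [indicator_of_mem hyI, Pi.one_apply, mul_one]
        rw [← ENNReal.ofReal_mul (pow_nonneg (le_of_lt hy) _)]
        refine ENNReal.ofReal_le_ofReal ?_
        have hb := pow_mul_exp_neg_sq_div_le hd1 hn (le_of_lt hy)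
        calc y ^ (d - 1) * (c * rexp (-y ^ 2 / (2 * n ^ 2))) = c * (y ^ (d - 1) * rexp (-y ^ 2 / (2 * n ^ 2))) := by
              ring
          _ ≤ c * (n ^ (d - 1) * M) := mul_le_mul_of_nonneg_left hb hc0
      · rw [hf]
        simp only [indicator_of_notMem hyI, mul_zero, le_refl]
    calc ∫⁻ y in Ioi (0 : ℝ), ENNReal.ofReal (y ^ (d - 1)) * f y
        ≤ ∫⁻ y in Ioi (0 : ℝ), (Ico a a').indicator (fun _ => ENNReal.ofReal (c * (n ^ (d - 1) * M))) y :=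
          setLIntegral_mono (measurable_const.indicator measurableSet_Ico) hpt
      _ ≤ ∫⁻ y, (Ico a a').indicator (fun _ => ENNReal.ofReal (c * (n ^ (d - 1) * M))) y :=
          setLIntegral_le_lintegral _ _
      _ = ENNReal.ofReal (c * (n ^ (d - 1) * M)) * volume (Ico a a') := by
          rw [lintegral_indicator measurableSet_Ico, setLIntegral_const]
      _ = ENNReal.ofReal (c * (n ^ (d - 1) * M) * (a' - a)) := by
          rw [Real.volume_Ico, ← ENNReal.ofReal_mul (by positivity)]
  have hball : (volume : Measure F) (ball 0 1) = ENNReal.ofReal ((volume : Measure F).real (ball 0 1)) := by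
    rw [measureReal_def, ENNReal.ofReal_toReal measure_ball_lt_top.ne]
  have hff : (fun y : F => ENNReal.ofReal ((2 * π) ^ (-(finrank ℝ F : ℝ) / 2) * rexp (-‖y‖ ^ 2 / (2 * n ^ 2))) *
      (Ico a a').indicator 1 ‖y‖) = fun y : F => f ‖y‖ := by
    funext y
    rw [hf]
  rw [hff, h2]
  calc (finrank ℝ F : ℝ≥0∞) * volume (ball (0 : F) 1) * ∫⁻ y in Ioi (0 : ℝ), ENNReal.ofReal (y ^ (finrank ℝ F - 1)) * f y
      ≤ (finrank ℝ F : ℝ≥0∞) * volume (ball (0 : F) 1) * ENNReal.ofReal (c * (n ^ (d - 1) * M) * (a' - a)) := by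
        gcongr
    _ = ENNReal.ofReal (n ^ (finrank ℝ F - 1) * radialShellConst F * (a' - a)) := by
        rw [hball, radialShellConst, ← hd, ← ENNReal.ofReal_natCast d,
          ← ENNReal.ofReal_mul (by positivity), ← ENNReal.ofReal_mul (by positivity)]
        congr 1
        simp only [hc, hM]
        ring

/-- **THE CUT-OFF SHELL OF A 𝔤-VALUED BOND VARIABLE WITH AN ANISOTROPIC (centred) COVARIANCE**: for an invertible linear
map `A` of the `m`-dimensional space (the bond block `B(b) = A z` of the fluctuation field, `z` standard Gaussian; block
covariance `AAᵀ`) and any real `a, a′`,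
`𝒩{z : a ≤ ‖A z‖ < a′} ≤ ‖A‖^{m−1}·|det A|⁻¹·K_m·(a′ − a)` — change of variables `y = Az` (Mathlib
`Measure.map_linearMap_addHaar_eq_smul_addHaar`: `A_* dz = |det A|⁻¹ dy`), the Gaussian density at `A⁻¹y` dominated by the
RADIAL `e^{−‖y‖²/(2‖A‖²)}` (`‖y‖ ≤ ‖A‖·‖A⁻¹y‖`), then `lintegral_scaledRadialShell_le`.  What stays typed as residual (R-9):
a NON-ZERO MEAN (the linear term of [II] (2.23) — avoidable by integrating the auxiliary field `X` first, which leaves a centred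
quadratic tilt, record §27.5). [cite: Balaban1988RG2Cluster, (1.34) p.9, (2.3) p.12 and (2.23) p.17; Balaban1987RG1, (2.9) p.266] -/
theorem stdGaussian_linearRadialShell_le [Nontrivial F] (A : F ≃ₗ[ℝ] F) (a a' : ℝ) :
    stdGaussian F {z : F | a ≤ ‖A z‖ ∧ ‖A z‖ < a'} ≤
      ENNReal.ofReal (|(LinearMap.det (A : F →ₗ[ℝ] F))⁻¹| *
        (‖LinearMap.toContinuousLinearMap (A : F →ₗ[ℝ] F)‖ ^ (finrank ℝ F - 1) * radialShellConst F * (a' - a))) := by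
  set L : F →ₗ[ℝ] F := (A : F →ₗ[ℝ] F) with hL
  set T : F →L[ℝ] F := LinearMap.toContinuousLinearMap L with hT
  have hTapply : ∀ x, T x = A x := fun x => rfl
  have hdet : LinearMap.det L ≠ 0 := (LinearEquiv.isUnit_det' A).ne_zero
  -- the operator norm is positive (F is nontrivial, A injective)
  have hn : 0 < ‖T‖ := by
    obtain ⟨x, hx⟩ := exists_ne (0 : F)
    have hAx : A x ≠ 0 := fun h => hx (A.map_eq_zero_iff.1 h)
    have h1 : ‖A x‖ ≤ ‖T‖ * ‖x‖ := by rw [← hTapply]; exact T.le_opNorm x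
    have h2 : 0 < ‖A x‖ := norm_pos_iff.2 hAx
    have h3 : 0 < ‖x‖ := norm_pos_iff.2 hx
    nlinarith [norm_nonneg T]
  set c : ℝ := (2 * π) ^ (-(finrank ℝ F : ℝ) / 2) with hc
  have hc0 : 0 ≤ c := by positivity
  set S : Set F := {y : F | a ≤ ‖y‖ ∧ ‖y‖ < a'} with hS
  have hSeq : S = (fun y : F => ‖y‖) ⁻¹' Ico a a' := by
    ext y; simp [hS, Set.mem_Ico]
  have hSm : MeasurableSet S := by
    rw [hSeq]; exact measurable_norm measurableSet_Ico
  have hLm : Measurable L := L.continuous_of_finiteDimensional.measurable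
  have hpre : {z : F | a ≤ ‖A z‖ ∧ ‖A z‖ < a'} = L ⁻¹' S := by
    ext z; simp [hS, hL]
  have hpreM : MeasurableSet (L ⁻¹' S) := hLm hSm
  -- the transported integrand
  set G : F → ℝ≥0∞ := fun y => ENNReal.ofReal (c * rexp (-‖A.symm y‖ ^ 2 / 2)) * S.indicator 1 y with hG
  have hGm : Measurable G := by
    refine Measurable.mul ?_ (measurable_one.indicator hSm)
    have hsymm : Measurable (A.symm : F → F) :=
      (A.symm : F →ₗ[ℝ] F).continuous_of_finiteDimensional.measurable
    exact (by fun_prop : Measurable fun y : F => ENNReal.ofReal (c * rexp (-‖y‖ ^ 2 / 2))).comp hsymm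
  -- Step 1: Gaussian measure → Lebesgue integral of G ∘ A
  have h1 : stdGaussian F (L ⁻¹' S) = ∫⁻ z, G (L z) ∂(volume : Measure F) := by
    rw [← lintegral_indicator_one hpreM, lintegral_stdGaussian_eq_lintegral_mul (measurable_one.indicator hpreM)]
    refine lintegral_congr fun z => ?_
    have hind : (L ⁻¹' S).indicator (1 : F → ℝ≥0∞) z = S.indicator 1 (L z) := rfl
    have hz : A.symm (L z) = z := by rw [hL]; exact A.symm_apply_apply z
    rw [hind, hG]
    simp only [hz]
    rfl
  -- Step 2: change of variables y = A z
  have h2 : ∫⁻ z, G (L z) ∂(volume : Measure F) =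
      ENNReal.ofReal |(LinearMap.det L)⁻¹| * ∫⁻ y, G y ∂(volume : Measure F) := by
    rw [← lintegral_map hGm hLm, Measure.map_linearMap_addHaar_eq_smul_addHaar _ hdet, lintegral_smul_measure,
      smul_eq_mul]
  -- Step 3: radial domination of the transported density
  have h3 : ∀ y, G y ≤ ENNReal.ofReal (c * rexp (-‖y‖ ^ 2 / (2 * ‖T‖ ^ 2))) * (Ico a a').indicator 1 ‖y‖ := by
    intro y
    have hind : S.indicator (1 : F → ℝ≥0∞) y = (Ico a a').indicator 1 ‖y‖ := by rw [hSeq]; rfl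
    rw [hG]
    simp only [hind]
    refine mul_le_mul' (ENNReal.ofReal_le_ofReal (mul_le_mul_of_nonneg_left ?_ hc0)) le_rfl
    apply Real.exp_le_exp.2
    have hy : ‖y‖ ≤ ‖T‖ * ‖A.symm y‖ := by
      have := T.le_opNorm (A.symm y)
      rwa [hTapply, A.apply_symm_apply] at this
    have hy2 : ‖y‖ ^ 2 ≤ ‖T‖ ^ 2 * ‖A.symm y‖ ^ 2 := by
      rw [← mul_pow]; exact pow_le_pow_left₀ (norm_nonneg _) hy 2
    have hT2 : 0 < ‖T‖ ^ 2 := by positivity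
    have key : ‖y‖ ^ 2 / ‖T‖ ^ 2 ≤ ‖A.symm y‖ ^ 2 := by
      rw [div_le_iff₀ hT2, mul_comm]; exact hy2
    have e : -‖y‖ ^ 2 / (2 * ‖T‖ ^ 2) = -(‖y‖ ^ 2 / ‖T‖ ^ 2) / 2 := by
      field_simp
    rw [e]
    linarith [key]
  -- assemble
  rw [hpre, h1, h2]
  calc ENNReal.ofReal |(LinearMap.det L)⁻¹| * ∫⁻ y, G y ∂(volume : Measure F)
      ≤ ENNReal.ofReal |(LinearMap.det L)⁻¹| *
          ∫⁻ y, ENNReal.ofReal (c * rexp (-‖y‖ ^ 2 / (2 * ‖T‖ ^ 2))) * (Ico a a').indicator 1 ‖y‖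
            ∂(volume : Measure F) := mul_le_mul' le_rfl (lintegral_mono h3)
    _ ≤ ENNReal.ofReal |(LinearMap.det L)⁻¹| *
          ENNReal.ofReal (‖T‖ ^ (finrank ℝ F - 1) * radialShellConst F * (a' - a)) :=
        mul_le_mul' le_rfl (lintegral_scaledRadialShell_le hn a a')
    _ = ENNReal.ofReal (|(LinearMap.det L)⁻¹| *
          (‖T‖ ^ (finrank ℝ F - 1) * radialShellConst F * (a' - a))) := by
        rw [← ENNReal.ofReal_mul (abs_nonneg _)]

end Summit.QuantumFields.BalabanUV.T4Continuum.NE9RadialShell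

end
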